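import Literature.AlgebraicGeometry.ModuliOfAbelianVarieties.SymplecticLiftOfMarking
import HarnessLib

/-!
# The integer frames of a symplectic lift read through a marking: `Λ_M = η_a ∘ Ā_M`, `Ā_M ∈ GL_{2g}(ℤ/M)` compatible
# ([Deligne 1971] 4.12 (b) «`k : T̂(B) ⥲ V_ẑ` from the `k_n`»; [Milne 2005] §6 Thm. 6.11, (63) `η = u ∘ a`; [Lan 2013] Lemma 1.3.6.5)

Topic `AlgebraicGeometry/ModuliOfAbelianVarieties`; namespace
`Literature.AlgebraicGeometry.ModuliOfAbelianVarieties.SiegelAdelicMarking`.  Cell hodgecm-mathlib (D-0151), rung-0 U-DAG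
brick B4, the **(d)-INPUT ADAPTER** (router B-plan1 R58; director s109): THEOREMS ONLY (no definition, no named fact, no
instance, no `sorry`); ★ T1′ `SiegelAdelicMarking` / ★ R60-58 `SiegelAdelicCongrTransport` / ★ D3
`LevelStructure.SymplecticLift` / ★ B4 (b) `SymplecticLiftOfMarking` currency.  HC_CM is proved only modulo the 7 printed
citations until rung 0 closes.

SETTING (as in ★ B4 (b), with the abelian scheme called `X`).  `X` an abelian scheme over `S` with a level-`N` structure `φ`, `s : Spec ℂ → S`, the fibre
`A := X(s)`, a divisor `Θ` on it, a D3 SYMPLECTIC LIFT `Λ` of `(φ, Θ)` of type `δ` at `s` (a compatible tower of group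
isomorphisms `Λ_M : (ℤ/M)^{2g} ⥲ A[M](ℂ)`, `N ∣ M`), and a T1′ MARKING `m` of `A` by `[J, a]` (ANY `a ∈ GSp_δ(𝔸_f)`), with
torsion parametrisation `u = m.r`.  A point `P` is READ at the class `c` through `a` when `P = u(w)` for every `w` with
`a⁻¹ ŵ ≡ ĉ (mod ẑ^{2g})` (★ `AdelicCongr a⁻¹ 1 w c`); `x̃/M := ((x i).val / M)ᵢ` is the rational lift of `x ∈ (ℤ/M)^{2g}`.

* §1 **Reading classes.**  Every `M`-torsion point `T ∈ A[M](ℂ)` is read at exactly ONE class `x̃/M`, `x ∈ (ℤ/M)^{2g}`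
  (`existsUnique_readingClass`; ★ (b) §1 exhaustion + well-definedness, ★ `eq_zero_of_valDiv_mem_latticeOfGL_one`) —
  i.e. «`η_a = u ∘ a` identifies `(ℤ/M)^{2g} = M⁻¹ẑ^{2g}/ẑ^{2g}` with `A[M](ℂ)`» read backwards.
* §2 **`exists_frames_of_symplecticLift`** — THE FRAMES: there are integer matrices `A_M, B_M ∈ M_{2g}(ℤ)` (`N ∣ M`),
  COMPATIBLE along the tower (`A_{M′} ≡ A_M (mod M)` for `M ∣ M′`), MUTUALLY INVERSE modulo `M`, such that the level-`M`
  layer of the lift is READ THROUGH `a` IN THE FRAME `A_M`: `a⁻¹ ŵ ≡ (Ā_M x)~/M ⟹ Λ_M(x) = u(w)` (`Ā_M = A_M mod M`).  In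
  words: `Ā_M := η_{a,M}⁻¹ ∘ Λ_M ∈ GL_{2g}(ℤ/M)` is the matrix of the lift in the marking's torsion coordinates, and
  `(A_M)_M` is an element of `GL_{2g}(ẑ) = lim GL_{2g}(ℤ/M)` written as a compatible family ([Deligne1971TravauxShimura]
  4.12 (b): the `k_n : B_n ⥲ V_ℤ/nV_ℤ` assemble to `k : T̂(B) → V_ẑ`).  The four frame clauses are BYTE-IDENTICAL to the
  first four hypotheses `hA hB hAB hBA` of ★ `Literature.NumberTheory.Adeles.exists_mem_principalLevelSubgroup_one_of_compatible`
  (`IntegralAdelesInverseLimit`), which turns a compatible tower of SYMPLECTIC frames into one `γ ∈ K_δ(1) = GSp_δ(ẑ)`;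
  the symplectic clauses `hn hn' hnn' hsymp` (from `Λ.pairing` and the D5 identity for the marking) are NOT produced
  here — this file is pairing-free.

Proof shape: the reading class `σ_M(x)` of `Λ_M(x)` is unique (§1), hence ADDITIVE (`Λ_M`, `u` and `x ↦ x̃/M` are
additive modulo `ℤ^{2g}`), INVERTIBLE (the reading class of a point is attained: `u(w)` is `M`-torsion and `Λ_M` is
onto) and TOWER-COMPATIBLE (`Λ.lift_compat` + ★ `valDiv_castHom_sub_nsmul_mem_latticeOfGL_one`); `Ā_M` is its matrix
on the standard basis and `A_M` the entrywise `ZMod.val` lift.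

## References
* [Deligne1971TravauxShimura] P. Deligne, *Travaux de Shimura*, Sém. Bourbaki 389 (1971), 4.12 (b) pp. 148–149, 4.16 p. 150.
* [Milne2005ShimuraVarieties] J. S. Milne, *Introduction to Shimura varieties* (2005), §6 Thm. 6.11 p. 74 and p. 75,
  §12 (63) p. 116 (`η = u ∘ a`).
* [Lan2013PELCompactifications] K.-W. Lan, *Arithmetic compactifications of PEL-type Shimura varieties* (2013), §1.3.6
  Def. 1.3.6.2 (p. 80), Lemma 1.3.6.5 (p. 81).
-/

set_option autoImplicit false

noncomputable section

open Matrix CategoryTheory AlgebraicGeometry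
open Literature.AlgebraicGeometry.Motives (AbelianVariety AlgPoints CartierDivisor)
open Literature.AlgebraicGeometry.AbelianSchemes (AbelianSchemeOver)
open Literature.NumberTheory.Adeles (latticeOfGL mem_latticeOfGL_one_iff)

namespace Literature.AlgebraicGeometry.ModuliOfAbelianVarieties

namespace SiegelAdelicMarking

variable {g : ℕ} {δ : Fin g → ℕ}

/-! ### §1. The reading class of a torsion point -/

section ReadingClass

variable {J : C0pm δ} {a : gspFinAdelic δ} {A : AbelianVariety ℂ} (m : SiegelAdelicMarking J a A)

/-- `(x − y)~/M ≡ x̃/M − ỹ/M (mod ℤ^{2g})`. [cite: Milne2005ShimuraVarieties, §6 p. 75] -/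
theorem valDiv_sub_sub_mem_latticeOfGL_one (M : ℕ) (x y : Fin g ⊕ Fin g → ZMod M) :
    ((fun i => (((x - y) i).val : ℚ) / M) - ((fun i => ((x i).val : ℚ) / M) - fun i => ((y i).val : ℚ) / M)) ∈
      latticeOfGL (1 : GL (Fin g ⊕ Fin g) finAdeleQ) := by
  -- `((x - y) + y)~ ≡ (x - y)~ + ỹ`
  have h := valDiv_add_sub_mem_latticeOfGL_one M (x - y) y
  rw [sub_add_cancel] at h
  have e : ((fun i => (((x - y) i).val : ℚ) / M) - ((fun i => ((x i).val : ℚ) / M) - fun i => ((y i).val : ℚ) / M)) =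
      -((fun i => ((x i).val : ℚ) / M) - ((fun i => (((x - y) i).val : ℚ) / M) + fun i => ((y i).val : ℚ) / M)) := by
    abel
  rw [e]
  exact neg_mem h

/-- **Uniqueness of the reading class**: if `u(v) = u(w)` with `a⁻¹ v̂ ≡ x̃/M` and `a⁻¹ ŵ ≡ ỹ/M` (`M ≠ 0`), then `x = y`
(`x̃/M − ỹ/M ∈ ℤ^{2g}` by ★ (b) §1 well-definedness, and `0 ≤ x̃ᵢ, ỹᵢ < M`).
[cite: Milne2005ShimuraVarieties, §6 Thm. 6.11 p. 74 and p. 75] -/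
theorem readingClass_eq_of_r_eq {M : ℕ} (hM : M ≠ 0) {x y : Fin g ⊕ Fin g → ZMod M} {v w : Fin g ⊕ Fin g → ℚ}
    (hv : AdelicCongr ((a⁻¹ : gspFinAdelic δ) : GL (Fin g ⊕ Fin g) finAdeleQ) 1 v (fun i => ((x i).val : ℚ) / M))
    (hw : AdelicCongr ((a⁻¹ : gspFinAdelic δ) : GL (Fin g ⊕ Fin g) finAdeleQ) 1 w (fun i => ((y i).val : ℚ) / M))
    (h : m.r v = m.r w) : x = y := by
  have hxy := (m.r_eq_r_iff_of_adelicCongr_one hv hw).1 h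
  have hsub := add_mem (valDiv_sub_sub_mem_latticeOfGL_one M x y) hxy
  rw [sub_add_cancel] at hsub
  exact sub_eq_zero.1 (eq_zero_of_valDiv_mem_latticeOfGL_one hM (x - y) hsub)

/-- **Every `M`-torsion point has exactly one reading class** (`M ≠ 0`): for `T ∈ A[M](ℂ)` there is a unique
`x ∈ (ℤ/M)^{2g}` with `T = u(w)` for EVERY `w` such that `a⁻¹ ŵ ≡ x̃/M` — «`η_a = u ∘ a` identifies `(ℤ/M)^{2g}` with
`A[M](ℂ)`», read backwards. [cite: Milne2005ShimuraVarieties, §6 Thm. 6.11 p. 74 and §12 (63) p. 116]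
[cite: Deligne1971TravauxShimura, 4.12 (b) pp. 148–149] -/
theorem existsUnique_readingClass {M : ℕ} (hM : M ≠ 0) {T : A.Points ℂ} (hT : T ∈ A.torsionPoints ℂ (M : ℤ)) :
    ∃! x : Fin g ⊕ Fin g → ZMod M, ∀ w : Fin g ⊕ Fin g → ℚ,
      AdelicCongr ((a⁻¹ : gspFinAdelic δ) : GL (Fin g ⊕ Fin g) finAdeleQ) 1 w (fun i => ((x i).val : ℚ) / M) →
        T = m.r w := by
  obtain ⟨x, v, hv, hvT⟩ := m.exists_adelicCongr_one_valDiv_r_eq hM hT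
  refine ⟨x, fun w hw => m.forall_eq_r_of_adelicCongr_one hv hvT.symm w hw, fun y hy => ?_⟩
  obtain ⟨w, hw⟩ := exists_adelicCongr_inv_one (a := a) (fun i => ((y i).val : ℚ) / M)
  exact (m.readingClass_eq_of_r_eq hM hv hw (hvT.trans (hy w hw))).symm

end ReadingClass

/-! ### §2. The frames of a symplectic lift read through a marking -/

section Frames

variable {J : C0pm δ} {a : gspFinAdelic δ}
variable {N : ℕ} {S : Scheme} {X : AbelianSchemeOver S} {s : Spec (.of ℂ) ⟶ S}

/-- `Pi.single j 1` is preserved by reduction `ℤ/M′ → ℤ/M`. [folklore] -/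
private theorem castHom_comp_single {M M' : ℕ} (h : M ∣ M') (j : Fin g ⊕ Fin g) :
    (fun i => ZMod.castHom h (ZMod M) ((Pi.single j (1 : ZMod M') : Fin g ⊕ Fin g → ZMod M') i)) =
      (Pi.single j (1 : ZMod M) : Fin g ⊕ Fin g → ZMod M) := by
  funext i
  by_cases hij : i = j
  · subst hij; rw [Pi.single_eq_same, Pi.single_eq_same, map_one]
  · rw [Pi.single_eq_of_ne hij, Pi.single_eq_of_ne hij, map_zero]

/-- The entrywise `ZMod.val` lift of a matrix over `ℤ/M` reduces back to it. [folklore] -/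
private theorem map_val_map_intCast {M : ℕ} [NeZero M] (X : Matrix (Fin g ⊕ Fin g) (Fin g ⊕ Fin g) (ZMod M)) :
    (X.map fun z => ((z.val : ℕ) : ℤ)).map (Int.castRingHom (ZMod M)) = X := by
  ext i j
  simp

/-- `(M : ℤ) ∣ b − a ↔ (a : ℤ/M) = b`, on lifted entries. [folklore] -/
private theorem dvd_sub_iff_cast_eq {M : ℕ} (a b : ℤ) : (M : ℤ) ∣ b - a ↔ ((a : ZMod M) = (b : ZMod M)) :=
  (ZMod.intCast_eq_intCast_iff_dvd_sub a b M).symm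

/-- **THE FRAMES OF A SYMPLECTIC LIFT READ THROUGH A MARKING** ((d)-input adapter; [Deligne1971TravauxShimura] 4.12 (b)
«isomorphismes `k_n : B_n ⥲ V_ℤ/nV_ℤ` … se relever en … `k : T̂(B) → V_ẑ`», [Milne2005ShimuraVarieties] (63) `η = u ∘ a`).
Let `Λ` be a symplectic lift of `(φ, Θ)` of type `δ` at `s` and `m` a marking of the fibre by `[J, a]`.  Then
there are integer matrices `A_M, B_M` (`M ∈ ℕ`; meaningful for `N ∣ M ≠ 0`) such that
(`hA`, `hB`) the families are COMPATIBLE along the tower, `M ∣ A_{M′} − A_M` and `M ∣ B_{M′} − B_M` entrywise for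
`N ∣ M ∣ M′`; (`hAB`, `hBA`) `A_M B_M ≡ 1 ≡ B_M A_M (mod M)`; and (READING) for every `x ∈ (ℤ/M)^{2g}` and every `w`
with `a⁻¹ ŵ ≡ (Ā_M x)~/M (mod ẑ^{2g})`, `Ā_M := A_M mod M`, one has `Λ_M(x) = u(w)` — the level-`M` layer of the lift is
the marking's torsion parametrisation IN THE FRAME `A_M`.  The four frame clauses are verbatim the hypotheses
`hA hB hAB hBA` of ★ `exists_mem_principalLevelSubgroup_one_of_compatible`.  (`Ā_M = η_{a,M}⁻¹ ∘ Λ_M`; for `M` not a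
level the matrices are unconstrained junk.)
[cite: Deligne1971TravauxShimura, 4.12 (b) pp. 148–149 and 4.16 p. 150] [cite: Milne2005ShimuraVarieties, §6 Thm. 6.11 p. 74 and §12 (63) p. 116]
[cite: Lan2013PELCompactifications, §1.3.6 Lemma 1.3.6.5 (p. 81)] -/
theorem exists_frames_of_symplecticLift {φ : X.LevelStructure g N}
    {Θ : CartierDivisor (X.fibre s).toAbelianVariety.X.left} (Λ : φ.SymplecticLift s Θ δ)
    (m : SiegelAdelicMarking J a (X.fibre s).toAbelianVariety) :
    ∃ A B : ℕ → Matrix (Fin g ⊕ Fin g) (Fin g ⊕ Fin g) ℤ,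
      (∀ M M' : ℕ, M ≠ 0 → M' ≠ 0 → N ∣ M → M ∣ M' → ∀ i j, (M : ℤ) ∣ A M' i j - A M i j) ∧
      (∀ M M' : ℕ, M ≠ 0 → M' ≠ 0 → N ∣ M → M ∣ M' → ∀ i j, (M : ℤ) ∣ B M' i j - B M i j) ∧
      (∀ M, M ≠ 0 → N ∣ M → ∀ i j, (M : ℤ) ∣ (A M * B M) i j - (1 : Matrix _ _ ℤ) i j) ∧
      (∀ M, M ≠ 0 → N ∣ M → ∀ i j, (M : ℤ) ∣ (B M * A M) i j - (1 : Matrix _ _ ℤ) i j) ∧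
      ∀ ⦃M : ℕ⦄, N ∣ M → M ≠ 0 → ∀ (x : Fin g ⊕ Fin g → ZMod M) (w : Fin g ⊕ Fin g → ℚ),
        AdelicCongr ((a⁻¹ : gspFinAdelic δ) : GL (Fin g ⊕ Fin g) finAdeleQ) 1 w
            (fun i => ((((A M).map (Int.castRingHom (ZMod M)) *ᵥ x) i).val : ℚ) / M) →
          ((Λ.lift M (Multiplicative.ofAdd x)) : (X.fibre s).toAbelianVariety.Points ℂ) = m.r w := by
  classical
  /- (1) the reading class `σ M x` of `Λ_M(x)` (total in `M`; meaningful at the levels) -/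
  have hexσ : ∀ (M : ℕ) (x : Fin g ⊕ Fin g → ZMod M), ∃ y : Fin g ⊕ Fin g → ZMod M, N ∣ M → M ≠ 0 →
      ∀ w : Fin g ⊕ Fin g → ℚ,
        AdelicCongr ((a⁻¹ : gspFinAdelic δ) : GL (Fin g ⊕ Fin g) finAdeleQ) 1 w (fun i => ((y i).val : ℚ) / M) →
          ((Λ.lift M (Multiplicative.ofAdd x)) : (X.fibre s).toAbelianVariety.Points ℂ) = m.r w := by
    intro M x
    by_cases h : N ∣ M ∧ M ≠ 0
    · obtain ⟨y, hy, -⟩ := m.existsUnique_readingClass h.2 (Λ.lift M (Multiplicative.ofAdd x)).2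
      exact ⟨y, fun _ _ => hy⟩
    · exact ⟨0, fun h1 h2 => (h ⟨h1, h2⟩).elim⟩
  choose σ hσ using hexσ
  /- (2) the inverse reading `τ M y`: the `x` with `Λ_M(x)` read at `ỹ/M` -/
  have hexτ : ∀ (M : ℕ) (y : Fin g ⊕ Fin g → ZMod M), ∃ x : Fin g ⊕ Fin g → ZMod M, N ∣ M → M ≠ 0 →
      ∀ w : Fin g ⊕ Fin g → ℚ,
        AdelicCongr ((a⁻¹ : gspFinAdelic δ) : GL (Fin g ⊕ Fin g) finAdeleQ) 1 w (fun i => ((y i).val : ℚ) / M) →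
          ((Λ.lift M (Multiplicative.ofAdd x)) : (X.fibre s).toAbelianVariety.Points ℂ) = m.r w := by
    intro M y
    by_cases h : N ∣ M ∧ M ≠ 0
    · obtain ⟨w₀, hw₀⟩ := exists_adelicCongr_inv_one (a := a) (fun i => ((y i).val : ℚ) / M)
      have htor : m.r w₀ ∈ (X.fibre s).toAbelianVariety.torsionPoints ℂ (M : ℤ) :=
        m.r_mem_torsionPoints_of_adelicCongr_one hw₀ (nsmul_valDiv_mem_latticeOfGL_one M y)
      obtain ⟨x, hx⟩ := (Λ.lift_bijective h.1 h.2).2 ⟨m.r w₀, htor⟩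
      refine ⟨Multiplicative.toAdd x, fun _ _ w hw => ?_⟩
      rw [ofAdd_toAdd, hx]
      exact m.forall_eq_r_of_adelicCongr_one hw₀ rfl w hw
    · exact ⟨0, fun h1 h2 => (h ⟨h1, h2⟩).elim⟩
  choose τ hτ using hexτ
  /- (3) at a level: uniqueness of reading classes gives `σ ∘ τ = id`, `τ ∘ σ = id`, additivity, compatibility -/
  have hστ : ∀ {M : ℕ}, N ∣ M → M ≠ 0 → ∀ y, σ M (τ M y) = y := by
    intro M hM hM0 y
    obtain ⟨w, hw⟩ := exists_adelicCongr_inv_one (a := a) (fun i => ((y i).val : ℚ) / M)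
    obtain ⟨w', hw'⟩ := exists_adelicCongr_inv_one (a := a) (fun i => ((σ M (τ M y) i).val : ℚ) / M)
    exact m.readingClass_eq_of_r_eq hM0 hw' hw ((hσ M _ hM hM0 w' hw').symm.trans (hτ M y hM hM0 w hw))
  have hτσ : ∀ {M : ℕ}, N ∣ M → M ≠ 0 → ∀ x, τ M (σ M x) = x := by
    intro M hM hM0 x
    obtain ⟨w, hw⟩ := exists_adelicCongr_inv_one (a := a) (fun i => ((σ M x i).val : ℚ) / M)
    have h1 := hσ M x hM hM0 w hw
    have h2 := hτ M (σ M x) hM hM0 w hw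
    have h3 : Λ.lift M (Multiplicative.ofAdd (τ M (σ M x))) = Λ.lift M (Multiplicative.ofAdd x) :=
      Subtype.ext (h2.trans h1.symm)
    exact Multiplicative.ofAdd.injective ((Λ.lift_bijective hM hM0).1 h3)
  have hadd : ∀ {M : ℕ}, N ∣ M → M ≠ 0 → ∀ x y, σ M (x + y) = σ M x + σ M y := by
    intro M hM hM0 x y
    obtain ⟨vx, hvx⟩ := exists_adelicCongr_inv_one (a := a) (fun i => ((σ M x i).val : ℚ) / M)
    obtain ⟨vy, hvy⟩ := exists_adelicCongr_inv_one (a := a) (fun i => ((σ M y i).val : ℚ) / M)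
    obtain ⟨u, hu⟩ := exists_adelicCongr_inv_one (a := a) (fun i => ((σ M (x + y) i).val : ℚ) / M)
    have hsum : AdelicCongr ((a⁻¹ : gspFinAdelic δ) : GL (Fin g ⊕ Fin g) finAdeleQ) 1 (vx + vy)
        (fun i => (((σ M x + σ M y) i).val : ℚ) / M) :=
      (hvx.add hvy).of_sub_mem_latticeOfGL_right (by rw [inv_one]; exact valDiv_add_sub_mem_latticeOfGL_one M _ _)
    refine m.readingClass_eq_of_r_eq hM0 hu hsum ?_
    rw [← hσ M (x + y) hM hM0 u hu, m.r_add, ← hσ M x hM hM0 vx hvx, ← hσ M y hM hM0 vy hvy, ofAdd_add, map_mul]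
    rfl
  have hcompat : ∀ {M : ℕ} (k : ℕ), N ∣ M → M ≠ 0 → k ≠ 0 → ∀ x : Fin g ⊕ Fin g → ZMod (k * M),
      σ M (fun i => ZMod.castHom (Dvd.intro_left k rfl) (ZMod M) (x i)) =
        fun i => ZMod.castHom (Dvd.intro_left k rfl) (ZMod M) (σ (k * M) x i) := by
    intro M k hM hM0 hk x
    have hkM : N ∣ k * M := Dvd.dvd.mul_left hM k
    have hkM0 : k * M ≠ 0 := Nat.mul_ne_zero hk hM0
    obtain ⟨w, hw⟩ := exists_adelicCongr_inv_one (a := a) (fun i => ((σ (k * M) x i).val : ℚ) / (k * M : ℕ))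
    obtain ⟨u, hu⟩ := exists_adelicCongr_inv_one (a := a)
      (fun i => ((σ M (fun i => ZMod.castHom (Dvd.intro_left k rfl) (ZMod M) (x i)) i).val : ℚ) / M)
    -- `k • w` names the reduced class
    have hkw : AdelicCongr ((a⁻¹ : gspFinAdelic δ) : GL (Fin g ⊕ Fin g) finAdeleQ) 1 (k • w)
        (fun i => ((ZMod.castHom (Dvd.intro_left k rfl) (ZMod M) (σ (k * M) x i)).val : ℚ) / M) :=
      (hw.nsmul k).of_sub_mem_latticeOfGL_right
        (by rw [inv_one]; exact valDiv_castHom_sub_nsmul_mem_latticeOfGL_one k hM0 hk _)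
    refine m.readingClass_eq_of_r_eq hM0 hu hkw ?_
    rw [← hσ M _ hM hM0 u hu, m.r_nsmul, ← hσ (k * M) x hkM hkM0 w hw]
    exact Λ.lift_compat k x hM hM0 hk
  /- (4) the matrices -/
  let Abar : (M : ℕ) → Matrix (Fin g ⊕ Fin g) (Fin g ⊕ Fin g) (ZMod M) :=
    fun M => Matrix.of fun i j => σ M (Pi.single j 1) i
  let Bbar : (M : ℕ) → Matrix (Fin g ⊕ Fin g) (Fin g ⊕ Fin g) (ZMod M) :=
    fun M => Matrix.of fun i j => τ M (Pi.single j 1) i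
  -- at a level, `σ M` is a linear map with matrix `Abar M`, and `τ M` its inverse with matrix `Bbar M`
  have hlin : ∀ {M : ℕ}, N ∣ M → M ≠ 0 →
      (∀ x, Abar M *ᵥ x = σ M x) ∧ Abar M * Bbar M = 1 ∧ Bbar M * Abar M = 1 := by
    intro M hM hM0
    haveI : NeZero M := ⟨hM0⟩
    let Fσ : (Fin g ⊕ Fin g → ZMod M) →+ (Fin g ⊕ Fin g → ZMod M) := AddMonoidHom.mk' (σ M) (hadd hM hM0)
    have haddτ : ∀ x y, τ M (x + y) = τ M x + τ M y := fun x y => by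
      have h := hadd hM hM0 (τ M x) (τ M y)
      rw [hστ hM hM0, hστ hM hM0] at h
      rw [← h, hτσ hM hM0]
    let Fτ : (Fin g ⊕ Fin g → ZMod M) →+ (Fin g ⊕ Fin g → ZMod M) := AddMonoidHom.mk' (τ M) haddτ
    let Lσ := Fσ.toZModLinearMap M
    let Lτ := Fτ.toZModLinearMap M
    have hLσ : ∀ x, Lσ x = σ M x := fun _ => rfl
    have hLτ : ∀ x, Lτ x = τ M x := fun _ => rfl
    have hAσ : Abar M = LinearMap.toMatrix' Lσ := by
      ext i j
      rw [LinearMap.toMatrix'_apply, hLσ]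
      simp only [Abar, Matrix.of_apply]
    have hBτ : Bbar M = LinearMap.toMatrix' Lτ := by
      ext i j
      rw [LinearMap.toMatrix'_apply, hLτ]
      simp only [Bbar, Matrix.of_apply]
    have hστ' : Lσ.comp Lτ = LinearMap.id := by
      apply LinearMap.ext; intro y; rw [LinearMap.comp_apply, hLτ, hLσ, hστ hM hM0]; rfl
    have hτσ' : Lτ.comp Lσ = LinearMap.id := by
      apply LinearMap.ext; intro x; rw [LinearMap.comp_apply, hLσ, hLτ, hτσ hM hM0]; rfl
    refine ⟨fun x => ?_, ?_, ?_⟩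
    · rw [hAσ, ← Matrix.toLin'_apply, Matrix.toLin'_toMatrix', hLσ]
    · rw [hAσ, hBτ, ← LinearMap.toMatrix'_comp, hστ', LinearMap.toMatrix'_id]
    · rw [hAσ, hBτ, ← LinearMap.toMatrix'_comp, hτσ', LinearMap.toMatrix'_id]
  -- compatibility of the matrices along the tower
  have hAcompat : ∀ {M : ℕ} (k : ℕ), N ∣ M → M ≠ 0 → k ≠ 0 → ∀ i j,
      Abar M i j = ZMod.castHom (Dvd.intro_left k rfl) (ZMod M) (Abar (k * M) i j) := by
    intro M k hM hM0 hk i j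
    simp only [Abar, Matrix.of_apply]
    have h := hcompat k hM hM0 hk (Pi.single j 1)
    rw [castHom_comp_single] at h
    exact congr_fun h i
  have hBcompat : ∀ {M : ℕ} (k : ℕ), N ∣ M → M ≠ 0 → k ≠ 0 → ∀ i j,
      Bbar M i j = ZMod.castHom (Dvd.intro_left k rfl) (ZMod M) (Bbar (k * M) i j) := by
    intro M k hM hM0 hk i j
    have hkM : N ∣ k * M := Dvd.dvd.mul_left hM k
    have hkM0 : k * M ≠ 0 := Nat.mul_ne_zero hk hM0
    simp only [Bbar, Matrix.of_apply]
    -- `τ` is compatible because `σ` is and both are inverse to each other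
    have h : τ M (Pi.single j 1) = fun i => ZMod.castHom (Dvd.intro_left k rfl) (ZMod M) (τ (k * M) (Pi.single j 1) i) := by
      have h1 := hcompat k hM hM0 hk (τ (k * M) (Pi.single j 1))
      rw [hστ hkM hkM0, castHom_comp_single] at h1
      -- `σ M (cast ∘ τ_{kM} e_j) = e_j`, so `cast ∘ τ_{kM} e_j = τ M e_j`
      have h2 := congr_arg (τ M) h1
      rw [hτσ hM hM0] at h2
      exact h2.symm
    exact congr_fun h i
  /- (5) the integer lifts -/
  refine ⟨fun M => (Abar M).map fun z => ((z.val : ℕ) : ℤ), fun M => (Bbar M).map fun z => ((z.val : ℕ) : ℤ),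
    ?_, ?_, ?_, ?_, ?_⟩
  · -- hA
    intro M M' hM0 hM'0 hM hMM' i j
    obtain ⟨k, rfl⟩ := hMM'
    have hk : k ≠ 0 := fun hk => hM'0 (by rw [hk, mul_zero])
    haveI : NeZero M := ⟨hM0⟩
    haveI : NeZero (k * M) := ⟨Nat.mul_ne_zero hk hM0⟩
    rw [mul_comm M k, dvd_sub_iff_cast_eq]
    simp only [Matrix.map_apply, Int.cast_natCast]
    rw [ZMod.natCast_zmod_val, ← ZMod.cast_eq_val, ← ZMod.castHom_apply (h := Dvd.intro_left k rfl)]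
    exact hAcompat k hM hM0 hk i j
  · -- hB
    intro M M' hM0 hM'0 hM hMM' i j
    obtain ⟨k, rfl⟩ := hMM'
    have hk : k ≠ 0 := fun hk => hM'0 (by rw [hk, mul_zero])
    haveI : NeZero M := ⟨hM0⟩
    haveI : NeZero (k * M) := ⟨Nat.mul_ne_zero hk hM0⟩
    rw [mul_comm M k, dvd_sub_iff_cast_eq]
    simp only [Matrix.map_apply, Int.cast_natCast]
    rw [ZMod.natCast_zmod_val, ← ZMod.cast_eq_val, ← ZMod.castHom_apply (h := Dvd.intro_left k rfl)]
    exact hBcompat k hM hM0 hk i j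
  · -- hAB
    intro M hM0 hM i j
    haveI : NeZero M := ⟨hM0⟩
    rw [dvd_sub_iff_cast_eq]
    have h := (hlin hM hM0).2.1
    have e : ((Abar M).map fun z => ((z.val : ℕ) : ℤ)).map (Int.castRingHom (ZMod M)) *
        ((Bbar M).map fun z => ((z.val : ℕ) : ℤ)).map (Int.castRingHom (ZMod M)) = 1 := by
      rw [map_val_map_intCast, map_val_map_intCast, h]
    rw [← Matrix.map_mul] at e
    have e' := congr_fun (congr_fun e i) j
    rw [Matrix.map_apply, eq_intCast] at e'
    rw [e', Matrix.one_apply, Matrix.one_apply]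
    split_ifs <;> simp
  · -- hBA
    intro M hM0 hM i j
    haveI : NeZero M := ⟨hM0⟩
    rw [dvd_sub_iff_cast_eq]
    have h := (hlin hM hM0).2.2
    have e : ((Bbar M).map fun z => ((z.val : ℕ) : ℤ)).map (Int.castRingHom (ZMod M)) *
        ((Abar M).map fun z => ((z.val : ℕ) : ℤ)).map (Int.castRingHom (ZMod M)) = 1 := by
      rw [map_val_map_intCast, map_val_map_intCast, h]
    rw [← Matrix.map_mul] at e
    have e' := congr_fun (congr_fun e i) j
    rw [Matrix.map_apply, eq_intCast] at e'
    rw [e', Matrix.one_apply, Matrix.one_apply]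
    split_ifs <;> simp
  · -- READING
    intro M hM hM0 x w hw
    haveI : NeZero M := ⟨hM0⟩
    rw [map_val_map_intCast, (hlin hM hM0).1 x] at hw
    exact hσ M x hM hM0 w hw

end Frames

end SiegelAdelicMarking

end Literature.AlgebraicGeometry.ModuliOfAbelianVarieties

end
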